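import Literature.Geometry.Lorentzian.SenParallelSpinorKID
import Literature.Geometry.Manifold.TranslationDevelopment
import HarnessLib

/-!
# From Sen–Witten-parallel spinors to the four translational KIDs with Gram matrix `η`

Sequel to `SenParallelSpinorKID.lean` (a Sen–Witten-parallel pair `(ψ, φ)` gives the Killing
initial datum `(⟪ψ, φ⟫, Σ ⟪ψ, σᵢφ⟫ Fᵢ)`). Here the output is assembled into the exact shape of
the analytic half `hA` of `positive_mass_rigidity_spacetime_of_kids_of_simplyConnected`
(`SpacetimePositiveMassRigidityReduction.lean`; Beig–Chruściel, J. Math. Phys. 37 (1996),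
Thm. 4.1 with App. A):

* `SenParallel.mdifferentiableAt_finset_sum` — derivative of a finite sum of maps into a
  normed space;
* `SenParallel.kid_of_parallel_sum` — **linear combinations of pairings of parallel spinors are
  KIDs** (`N = Σ_r c_r⟪α_r, β_r⟫`, `Y = Σᵢ (Σ_r c_r⟪α_r, σᵢβ_r⟫) Fᵢ`; with two parallel spinors
  and the complex structure these are the Hermitian forms `ψ_A†σ^μψ_B`, (A.11.0));
* `SenParallel.kidPairing_eq_of_connectedSpace` — **the Gram matrix `−N_aN_b + h(Y_a, Y_b)` of
  KIDs is constant on a connected data manifold** (its differential vanishes,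
  `mvfderiv_kidPairing_eq_zero`; manifold version of the chart-domain statement
  `InitialDataSet.kidPairing_eq_of_isPreconnected`); `gram_eq_of_tendsto` — so it equals its
  limit along any nontrivial filter (at infinity, where Witten's spinors are asymptotically
  constant); `lapse_pos_of_gram` — `N₀ > 0` propagates from one point (`N₀² = 1 + |Y₀|² ≥ 1`);
* `SenParallel.exists_kids_of_parallel_spinors` — **assembly**: smooth frame + finitely many
  smooth parallel spinor pairs + coefficients `c_{ar}`, Gram matrix `η` and `N₀ > 0` at one
  point ⟹ the six clauses of `hA` (smoothness of `N_a` and of the sections `Y_a`, shift and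
  lapse equations, Gram `η` everywhere, `N₀ > 0`);
  `SenParallel.exists_kids_of_parallel_spinors_of_tendsto` — the same with Gram `→ η` and
  `N₀ → c₀ > 0` along a nontrivial filter (at infinity), the form Witten's spinors deliver.

What then remains of `hA` is analysis only: a global orthonormal frame of the (parallelizable)
`3`-manifold, and Witten's existence theorem for `𝒟ψ = 0` with prescribed constant asymptotics
when `E_ADM = 0` (Witten 1981, §3; Parker–Taubes 1982; Beig–Chruściel 1996, App. A,
(A.7)–(A.9)). Theorems only; no definitions, no named facts.

## References

* R. Beig, P. T. Chruściel, *Killing vectors in asymptotically flat space-times. I*, J. Math.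
  Phys. 37 (1996) 1939–1961, arXiv:gr-qc/9510015: App. A, (A.7)–(A.11.0); proof of Thm. 4.1,
  §4. [BeigChrusciel1996]
* E. Witten, *A new proof of the positive energy theorem*, Comm. Math. Phys. 80 (1981)
  381–402, §3. [Witten1981]
* T. Parker, C. H. Taubes, *On Witten's proof of the positive energy theorem*, Comm. Math.
  Phys. 84 (1982) 223–238. [ParkerTaubes1982]
-/

noncomputable section

open Bundle Set Function Manifold Finset Filter
open scoped Manifold ContDiff Topology RealInnerProductSpace

namespace Literature.Geometry.Lorentzian

namespace SenParallel

/-! ### Calculus: derivative of a finite sum of maps into a normed space -/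

section Calculus

variable {E H M F' : Type*} [NormedAddCommGroup E] [NormedSpace ℝ E] [TopologicalSpace H]
  {I : ModelWithCorners ℝ E H} [TopologicalSpace M] [ChartedSpace H M]
  [NormedAddCommGroup F'] [NormedSpace ℝ F']

/-- **A finite sum of differentiable maps into a normed space is differentiable, with
derivative the sum of the derivatives.** [folklore] -/
theorem mdifferentiableAt_finset_sum {ι : Type*} (s : Finset ι) {f : ι → M → F'} {x : M}
    (hf : ∀ i ∈ s, MDiffAt (f i) x) :
    MDiffAt (fun y ↦ ∑ i ∈ s, f i y) x ∧
      mvfderiv I (fun y ↦ ∑ i ∈ s, f i y) x = ∑ i ∈ s, mvfderiv I (f i) x := by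
  classical
  induction s using Finset.induction_on with
  | empty =>
    simp only [Finset.sum_empty]
    exact ⟨mdifferentiableAt_const, mvfderiv_const (0 : F')⟩
  | insert a s ha ih =>
    have hfa : MDiffAt (f a) x := hf a (Finset.mem_insert_self a s)
    have ih' := ih fun i hi ↦ hf i (Finset.mem_insert_of_mem hi)
    have hfun : (fun y ↦ ∑ i ∈ insert a s, f i y) = f a + fun y ↦ ∑ i ∈ s, f i y := by
      funext y
      rw [Finset.sum_insert ha]
      rfl
    rw [hfun, Finset.sum_insert ha]
    exact ⟨hfa.add ih'.1, by rw [mvfderiv_add hfa ih'.1, ih'.2]⟩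

end Calculus

/-! ### Linear combinations of pairings -/

section Combination

variable {X : Type*} [TopologicalSpace X] [ChartedSpace E3 X] [IsManifold (𝓡 3) ∞ X]
  (D : InitialDataSet (𝓡 3) X) [D.metric.HasLeviCivita]
  {S : Type*} [NormedAddCommGroup S] [InnerProductSpace ℝ S]

/-- **Linear combinations of pairings of parallel spinors are Killing initial data.** In the
setting of `kid_of_parallel`, let `(α_r, β_r)_{r ∈ ι}` be finitely many pairs of
Sen–Witten-parallel spinor fields and `c_r` real constants. Then
`N = Σ_r c_r ⟪α_r, β_r⟫`, `Y = Σᵢ (Σ_r c_r ⟪α_r, σᵢβ_r⟫) Fᵢ` satisfy the lapse equation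
`dN(v) = −k(v, Y)` and the shift equation `h(∇ᵥY, w) = −N k(v, w)` (the KID system is linear).
With two parallel spinors `ψ₁, ψ₂` and the complex structure `J` these combinations realise the
Hermitian forms `ψ_A† σ^μ ψ_B`, i.e. the four translational KIDs of Beig–Chruściel 1996, App. A,
(A.11.0). [cite: BeigChrusciel1996, App. A, (A.10)–(A.11.0)] -/
theorem kid_of_parallel_sum (σ : Fin 3 → S →L[ℝ] S) (hsymm : ∀ i a b, ⟪σ i a, b⟫ = ⟪a, σ i b⟫)
    (hcl : ∀ i j a, σ i (σ j a) + σ j (σ i a) = if i = j then (2 : ℝ) • a else 0)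
    {F : Fin 3 → Π x : X, TangentSpace (𝓡 3) x}
    (hF : ∀ i x, MDifferentiableAt (𝓡 3) ((𝓡 3).prod 𝓘(ℝ, E3))
      (fun y ↦ (TotalSpace.mk' E3 y (F i y) : TangentBundle (𝓡 3) X)) x)
    (horth : ∀ x i j, D.h.inner x (F i x) (F j x) = if i = j then 1 else 0)
    (Ω : Fin 3 → Fin 3 → Π x : X, TangentSpace (𝓡 3) x → ℝ)
    (hω : ∀ i j x v, Ω i j x v = D.metric.val x (D.metric.leviCivita (F i) x v) (F j x))
    {ι : Type*} (s : Finset ι) (c : ι → ℝ) {α β : ι → X → S}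
    (hαd : ∀ r, MDifferentiable (𝓡 3) 𝓘(ℝ, S) (α r))
    (hβd : ∀ r, MDifferentiable (𝓡 3) 𝓘(ℝ, S) (β r))
    (hα : ∀ r (x : X) (v : TangentSpace (𝓡 3) x), mvfderiv (𝓡 3) (α r) x v =
      (1 / 4 : ℝ) • (∑ i, ∑ j, Ω i j x v • σ i (σ j (α r x))) -
        (1 / 2 : ℝ) • ∑ i, D.k x v (F i x) • σ i (α r x))
    (hβ : ∀ r (x : X) (v : TangentSpace (𝓡 3) x), mvfderiv (𝓡 3) (β r) x v =
      (1 / 4 : ℝ) • (∑ i, ∑ j, Ω i j x v • σ i (σ j (β r x))) -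
        (1 / 2 : ℝ) • ∑ i, D.k x v (F i x) • σ i (β r x))
    {N : X → ℝ} (hN : ∀ x, N x = ∑ r ∈ s, c r * ⟪α r x, β r x⟫)
    {Y : Π x : X, TangentSpace (𝓡 3) x}
    (hY : ∀ x, Y x = ∑ i, (∑ r ∈ s, c r * ⟪α r x, σ i (β r x)⟫) • F i x) :
    (∀ (x : X) (v : TangentSpace (𝓡 3) x), mvfderiv (𝓡 3) N x v = -(D.k x v (Y x))) ∧
      ∀ (x : X) (v w : TangentSpace (𝓡 3) x),
        D.metric.val x (D.metric.leviCivita Y x v) w = -(N x * D.k x v w) := by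
  -- each pairing is a KID
  have hkid : ∀ r, (∀ (x : X) (v : TangentSpace (𝓡 3) x),
      mvfderiv (𝓡 3) (fun y ↦ ⟪α r y, β r y⟫) x v =
        -(D.k x v (∑ i, ⟪α r x, σ i (β r x)⟫ • F i x))) ∧
      ∀ (x : X) (v w : TangentSpace (𝓡 3) x),
        D.metric.val x (D.metric.leviCivita (fun y ↦ ∑ i, ⟪α r y, σ i (β r y)⟫ • F i y) x v) w =
          -(⟪α r x, β r x⟫ * D.k x v w) := fun r ↦
    kid_of_parallel D σ hsymm hcl hF horth Ω hω (hαd r) (hβd r) (hα r) (hβ r) (fun _ ↦ rfl)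
      (fun _ ↦ rfl)
  have hNf : N = fun y ↦ ∑ r ∈ s, (fun r y ↦ c r * ⟪α r y, β r y⟫) r y := funext hN
  have hpd : ∀ r i x, MDifferentiableAt (𝓡 3) 𝓘(ℝ, ℝ) (fun y ↦ ⟪α r y, σ i (β r y)⟫) x :=
    fun r i x ↦
      mdifferentiableAt_real_inner (hαd r x) (mdifferentiableAt_clm_apply_comp (σ i) (hβd r x))
  have hpd0 : ∀ r x, MDifferentiableAt (𝓡 3) 𝓘(ℝ, ℝ) (fun y ↦ ⟪α r y, β r y⟫) x := fun r x ↦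
    mdifferentiableAt_real_inner (hαd r x) (hβd r x)
  -- derivative of a constant multiple
  have hcmul : ∀ (f : X → ℝ) (a : ℝ) (x : X) (v : TangentSpace (𝓡 3) x),
      MDifferentiableAt (𝓡 3) 𝓘(ℝ, ℝ) f x →
        MDifferentiableAt (𝓡 3) 𝓘(ℝ, ℝ) (fun y ↦ a * f y) x ∧
          mvfderiv (𝓡 3) (fun y ↦ a * f y) x v = a * mvfderiv (𝓡 3) f x v := by
    intro f a x v hf
    refine ⟨mdifferentiableAt_const.mul hf, ?_⟩
    rw [mvfderiv_fun_mul mdifferentiableAt_const hf, mvfderiv_const]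
    simp
  refine ⟨fun x v ↦ ?_, fun x v w ↦ ?_⟩
  · -- lapse equation: linearity of `d` and of `k(v, ·)`
    have h1 : mvfderiv (𝓡 3) N x v =
        ∑ r ∈ s, c r * -(D.k x v (∑ i, ⟪α r x, σ i (β r x)⟫ • F i x)) := by
      rw [hNf, (mdifferentiableAt_finset_sum s fun r _ ↦ (hcmul _ (c r) x v (hpd0 r x)).1).2,
        _root_.sum_apply]
      exact Finset.sum_congr rfl fun r _ ↦ by
        rw [(hcmul _ (c r) x v (hpd0 r x)).2, (hkid r).1 x v]
    rw [h1, hY x, map_sum]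
    simp only [map_sum, map_smul, smul_eq_mul, mul_neg, Finset.sum_neg_distrib, Finset.mul_sum,
      Finset.sum_mul]
    rw [Finset.sum_comm]
    simp only [mul_assoc]
  · -- shift equation: first against the frame
    set c' : Fin 3 → X → ℝ := fun i y ↦ ∑ r ∈ s, c r * ⟪α r y, σ i (β r y)⟫ with hc'
    have hYf : Y = fun y ↦ ∑ i, c' i y • F i y := funext hY
    have hc'd : ∀ i, MDifferentiableAt (𝓡 3) 𝓘(ℝ, ℝ) (c' i) x ∧
        mvfderiv (𝓡 3) (c' i) x v =
          ∑ r ∈ s, c r * mvfderiv (𝓡 3) (fun y ↦ ⟪α r y, σ i (β r y)⟫) x v := by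
      intro i
      have h := mdifferentiableAt_finset_sum (I := 𝓡 3) s (x := x)
        (f := fun r y ↦ c r * ⟪α r y, σ i (β r y)⟫)
        fun r _ ↦ (hcmul _ (c r) x v (hpd r i x)).1
      refine ⟨h.1, ?_⟩
      rw [h.2, _root_.sum_apply]
      exact Finset.sum_congr rfl fun r _ ↦ (hcmul _ (c r) x v (hpd r i x)).2
    -- the derivative of a single pairing coefficient, from the shift equation of that pairing
    have hsingle : ∀ r j, mvfderiv (𝓡 3) (fun y ↦ ⟪α r y, σ j (β r y)⟫) x v =
        -(⟪α r x, β r x⟫ * D.k x v (F j x)) -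
          ∑ i, ⟪α r x, σ i (β r x)⟫ * Ω i j x v := by
      intro r j
      have h := (hkid r).2 x v (F j x)
      rw [val_leviCivita_frameSum D hF horth (fun i ↦ hpd r i x) v j] at h
      simp only [← hω] at h
      linarith
    have hframe : ∀ j, D.metric.val x (D.metric.leviCivita Y x v) (F j x) =
        -(N x * D.k x v (F j x)) := by
      intro j
      rw [hYf, val_leviCivita_frameSum D hF horth (fun i ↦ (hc'd i).1) v j, (hc'd j).2, hN x]
      simp only [hsingle, ← hω, hc']
      simp only [mul_sub, mul_neg, Finset.sum_sub_distrib, Finset.sum_neg_distrib, Finset.mul_sum,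
        Finset.sum_mul]
      rw [Finset.sum_comm (s := s) (t := Finset.univ)]
      ring_nf
      congr 1
      exact Finset.sum_congr rfl fun r _ ↦ by ring
    have heq := clm_eq_of_frame D (horth x) (D.metric.val x (D.metric.leviCivita Y x v))
      (-(N x) • D.k x v) fun j ↦ by
        rw [hframe j, smul_apply, smul_eq_mul, neg_mul]
    have := DFunLike.congr_fun heq w
    rw [this, smul_apply, smul_eq_mul, neg_mul]

end Combination

/-! ### The Gram matrix of Killing initial data is constant on a connected data manifold -/

section Gram

variable {X : Type*} [TopologicalSpace X] [ChartedSpace E3 X] [IsManifold (𝓡 3) ∞ X]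
  (D : InitialDataSet (𝓡 3) X) [D.metric.HasLeviCivita]

/-- **The Lorentzian Gram matrix of translational KIDs is constant on a connected data
manifold** (manifold version of `InitialDataSet.kidPairing_eq_of_isPreconnected`, which is the
case of a chart domain): under the KID system for differentiable `(N_a, Y_a)`, `(N_b, Y_b)`, the
pairing `−N_aN_b + h(Y_a, Y_b)` has vanishing differential (`mvfderiv_kidPairing_eq_zero`,
`KillingInitialDataPairing.lean`), hence is locally constant
(`eventually_eq_of_mfderiv_eq_zero`), hence constant. In the proof of Beig–Chruściel 1996,
Thm. 4.1 this transports the asymptotic value `η_{ab}` of the spinor bilinears to all of `Σ`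
("`ĝ(X, X) = −1 ⟹ N² − |Y|² = 1`"). [cite: BeigChrusciel1996, proof of Thm. 4.1, §4] -/
theorem kidPairing_eq_of_connectedSpace [ConnectedSpace X] {ι : Type*} (N : ι → X → ℝ)
    (Y : ι → Π x : X, TangentSpace (𝓡 3) x)
    (hN : ∀ a x, MDifferentiableAt (𝓡 3) 𝓘(ℝ, ℝ) (N a) x)
    (hY : ∀ a x, MDifferentiableAt (𝓡 3) ((𝓡 3).prod 𝓘(ℝ, E3))
      (fun y ↦ (TotalSpace.mk' E3 y (Y a y) : TangentBundle (𝓡 3) X)) x)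
    (hDY : ∀ a (x : X) (v w : TangentSpace (𝓡 3) x),
      D.metric.val x (D.metric.leviCivita (Y a) x v) w = -(N a x * D.k x v w))
    (hdN : ∀ a (x : X) (v : TangentSpace (𝓡 3) x),
      mvfderiv (𝓡 3) (N a) x v = -(D.k x v (Y a x)))
    (a b : ι) (x x₀ : X) :
    -(N a x * N b x) + D.h.inner x (Y a x) (Y b x) =
      -(N a x₀ * N b x₀) + D.h.inner x₀ (Y a x₀) (Y b x₀) := by
  set φ : X → ℝ := fun y ↦ D.metric.val y (Y a y) (Y b y) - N a y * N b y with hφ_def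
  have hφd : ∀ y, MDifferentiableAt (𝓡 3) 𝓘(ℝ, ℝ) φ y := fun y ↦
    (D.metric.mdifferentiableAt_val_apply (hY a y) (hY b y)).sub ((hN a y).mul (hN b y))
  have hzero : ∀ (y : X) (v : TangentSpace (𝓡 3) y), mvfderiv (𝓡 3) φ y v = 0 := fun y v ↦ by
    have h := D.metric.mvfderiv_kidPairing_eq_zero D.k
      (FiberBundle.mdifferentiableAt_extend (I := 𝓡 3) (F := E3) v)
      (hY a y) (hY b y) (hN a y) (hN b y)
      (fun w ↦ hDY a y _ w) (fun w ↦ hDY b y _ w) (hdN a y _) (hdN b y _)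
    rwa [FiberBundle.extend_apply_self] at h
  have hmf : ∀ y, mfderiv (𝓡 3) 𝓘(ℝ, ℝ) φ y = 0 := fun y ↦
    ContinuousLinearMap.ext fun v ↦ hzero y v
  have hloc : IsLocallyConstant φ := by
    rw [IsLocallyConstant.iff_eventually_eq]
    intro y
    exact Literature.Geometry.Manifold.eventually_eq_of_mfderiv_eq_zero
      (Filter.Eventually.of_forall fun z ↦ ⟨hφd z, hmf z⟩)
  have h := hloc.apply_eq_of_isPreconnected isPreconnected_univ (mem_univ x) (mem_univ x₀)
  simp only [hφ_def, InitialDataSet.val_metric] at h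
  linarith

omit [TopologicalSpace X] [ChartedSpace E3 X] [IsManifold (𝓡 3) ∞ X] [D.metric.HasLeviCivita] in
/-- **A constant Gram matrix is fixed by its limit**: if the pairings `G_{ab}` are constant on
`X` and tend to `η_{ab}` along a nontrivial filter (e.g. at infinity along an asymptotically flat
end, where the Witten spinors are asymptotic to constant spinors), then `G_{ab} ≡ η_{ab}`.
[folklore] -/
theorem gram_eq_of_tendsto {ι : Type*} (G : ι → ι → X → ℝ) (c : ι → ι → ℝ)
    (hconst : ∀ a b x x₀, G a b x = G a b x₀) {l : Filter X} [l.NeBot]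
    (hlim : ∀ a b, Tendsto (G a b) l (𝓝 (c a b))) (a b : ι) (x : X) : G a b x = c a b := by
  have h : Tendsto (fun _ : X ↦ G a b x) l (𝓝 (c a b)) :=
    (hlim a b).congr fun y ↦ hconst a b y x
  exact tendsto_nhds_unique tendsto_const_nhds h

omit [D.metric.HasLeviCivita] in
/-- **Positivity of the timelike lapse propagates**: if `−N₀² + h(Y₀, Y₀) = −1` on a connected
`X` (so `N₀² = 1 + h(Y₀, Y₀) ≥ 1`, `h` Riemannian), `N₀` is continuous and positive at one
point, then `N₀ > 0` everywhere (`{N₀ > 0} = {N₀ ≥ 1}` is clopen).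
[cite: BeigChrusciel1996, proof of Thm. 4.1, §4] -/
theorem lapse_pos_of_gram [ConnectedSpace X] {N₀ : X → ℝ} {Y₀ : Π x : X, TangentSpace (𝓡 3) x}
    (hN : Continuous N₀) (hG : ∀ x, -(N₀ x * N₀ x) + D.h.inner x (Y₀ x) (Y₀ x) = -1)
    {x₀ : X} (hx₀ : 0 < N₀ x₀) (x : X) : 0 < N₀ x := by
  have hsq : ∀ y, 1 ≤ N₀ y * N₀ y := fun y ↦ by
    have hnn : 0 ≤ D.h.inner y (Y₀ y) (Y₀ y) := by
      by_cases hY : Y₀ y = 0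
      · simp [hY]
      · exact (D.isRiemannian_metric y (Y₀ y) hY).le
    linarith [hG y]
  have hU : {y | 0 < N₀ y} = {y | 1 ≤ N₀ y} := by
    ext y
    simp only [mem_setOf_eq]
    constructor
    · intro hy
      nlinarith [hsq y]
    · intro hy
      linarith
  have hclopen : IsClopen {y | 0 < N₀ y} :=
    ⟨by rw [hU]; exact isClosed_le continuous_const hN, isOpen_lt continuous_const hN⟩
  have huniv := hclopen.eq_univ ⟨x₀, hx₀⟩
  have hx : x ∈ {y | 0 < N₀ y} := by rw [huniv]; exact mem_univ x
  exact hx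

end Gram

/-! ### Assembly: the analytic half of the rigidity theorem from spinor data -/

section Assembly

variable {X : Type*} [TopologicalSpace X] [ChartedSpace E3 X] [IsManifold (𝓡 3) ∞ X]
  (D : InitialDataSet (𝓡 3) X) [D.metric.HasLeviCivita]
  {S : Type*} [NormedAddCommGroup S] [InnerProductSpace ℝ S]

/-- **Translational KIDs with Gram matrix `η` from Sen–Witten-parallel spinors.** On a connected
data manifold `(X, h, k)` with a smooth global `h`-orthonormal frame `(Fᵢ)` (connection
coefficients `ω_{ij}`), let `σᵢ` be symmetric Clifford operators on a real inner product space
`S`, let `(α_r, β_r)_r` be finitely many pairs of smooth Sen–Witten-parallel spinor fields and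
`c_{ar}` (`a < 4`) real coefficients, and put `N_a = Σ_r c_{ar}⟪α_r, β_r⟫`,
`Y_a = Σᵢ (Σ_r c_{ar}⟪α_r, σᵢβ_r⟫) Fᵢ`. If at one point `x₀` the Gram matrix
`−N_aN_b + h(Y_a, Y_b)` is `η_{ab}` and `N₀(x₀) > 0`, then `(N_a, Y_a)` is exactly the output
required by the analytic half `hA` of `positive_mass_rigidity_spacetime_of_kids_of_simplyConnected`:
smooth, shift and lapse equations, Gram matrix `η` everywhere, `N₀ > 0`. (What remains of `hA`
is Witten's analysis: the existence of the parallel spinors with these values at one point —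
equivalently at infinity, `gram_eq_of_tendsto`.) Beig–Chruściel 1996, App. A with Thm. 4.1.
[cite: BeigChrusciel1996, App. A, (A.7)–(A.11.0) and Thm. 4.1] -/
theorem exists_kids_of_parallel_spinors [ConnectedSpace X] (σ : Fin 3 → S →L[ℝ] S)
    (hsymm : ∀ i a b, ⟪σ i a, b⟫ = ⟪a, σ i b⟫)
    (hcl : ∀ i j a, σ i (σ j a) + σ j (σ i a) = if i = j then (2 : ℝ) • a else 0)
    {F : Fin 3 → Π x : X, TangentSpace (𝓡 3) x}
    (hF : ∀ i, ContMDiff (𝓡 3) ((𝓡 3).prod 𝓘(ℝ, E3)) ∞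
      fun y ↦ (TotalSpace.mk' E3 y (F i y) : TangentBundle (𝓡 3) X))
    (horth : ∀ x i j, D.h.inner x (F i x) (F j x) = if i = j then 1 else 0)
    (Ω : Fin 3 → Fin 3 → Π x : X, TangentSpace (𝓡 3) x → ℝ)
    (hω : ∀ i j x v, Ω i j x v = D.metric.val x (D.metric.leviCivita (F i) x v) (F j x))
    {ι : Type*} (s : Finset ι) (c : Fin 4 → ι → ℝ) {α β : ι → X → S}
    (hαs : ∀ r, ContMDiff (𝓡 3) 𝓘(ℝ, S) ∞ (α r)) (hβs : ∀ r, ContMDiff (𝓡 3) 𝓘(ℝ, S) ∞ (β r))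
    (hα : ∀ r (x : X) (v : TangentSpace (𝓡 3) x), mvfderiv (𝓡 3) (α r) x v =
      (1 / 4 : ℝ) • (∑ i, ∑ j, Ω i j x v • σ i (σ j (α r x))) -
        (1 / 2 : ℝ) • ∑ i, D.k x v (F i x) • σ i (α r x))
    (hβ : ∀ r (x : X) (v : TangentSpace (𝓡 3) x), mvfderiv (𝓡 3) (β r) x v =
      (1 / 4 : ℝ) • (∑ i, ∑ j, Ω i j x v • σ i (σ j (β r x))) -
        (1 / 2 : ℝ) • ∑ i, D.k x v (F i x) • σ i (β r x))
    (N : Fin 4 → X → ℝ) (hN : ∀ a x, N a x = ∑ r ∈ s, c a r * ⟪α r x, β r x⟫)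
    (Y : Fin 4 → Π x : X, TangentSpace (𝓡 3) x)
    (hY : ∀ a x, Y a x = ∑ i, (∑ r ∈ s, c a r * ⟪α r x, σ i (β r x)⟫) • F i x)
    {x₀ : X} (hG₀ : ∀ a b, -(N a x₀ * N b x₀) + D.h.inner x₀ (Y a x₀) (Y b x₀) =
      if a = b then (if a = 0 then -1 else 1) else 0) (hN₀ : 0 < N 0 x₀) :
    (∀ a, ContMDiff (𝓡 3) 𝓘(ℝ, ℝ) ∞ (N a)) ∧
      (∀ a, ContMDiff (𝓡 3) ((𝓡 3).prod (𝓡 3)) ∞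
        fun x ↦ (TotalSpace.mk' E3 x (Y a x) : TangentBundle (𝓡 3) X)) ∧
      (∀ a (x : X) (v w : TangentSpace (𝓡 3) x),
        D.metric.val x (D.metric.leviCivita (Y a) x v) w = -(N a x * D.k x v w)) ∧
      (∀ a (x : X) (v : TangentSpace (𝓡 3) x),
        mvfderiv (𝓡 3) (N a) x v = -(D.k x v (Y a x))) ∧
      (∀ (x : X) a b, -(N a x * N b x) + D.h.inner x (Y a x) (Y b x) =
        if a = b then (if a = 0 then -1 else 1) else 0) ∧
      ∀ x, 0 < N 0 x := by
  have hFd : ∀ i x, MDifferentiableAt (𝓡 3) ((𝓡 3).prod 𝓘(ℝ, E3))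
      (fun y ↦ (TotalSpace.mk' E3 y (F i y) : TangentBundle (𝓡 3) X)) x := fun i x ↦
    (hF i x).mdifferentiableAt (by simp)
  have hαd : ∀ r, MDifferentiable (𝓡 3) 𝓘(ℝ, S) (α r) := fun r x ↦
    (hαs r x).mdifferentiableAt (by simp)
  have hβd : ∀ r, MDifferentiable (𝓡 3) 𝓘(ℝ, S) (β r) := fun r x ↦
    (hβs r x).mdifferentiableAt (by simp)
  have hkid : ∀ a, (∀ (x : X) (v : TangentSpace (𝓡 3) x),
      mvfderiv (𝓡 3) (N a) x v = -(D.k x v (Y a x))) ∧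
      ∀ (x : X) (v w : TangentSpace (𝓡 3) x),
        D.metric.val x (D.metric.leviCivita (Y a) x v) w = -(N a x * D.k x v w) := fun a ↦
    kid_of_parallel_sum D σ hsymm hcl hFd horth Ω hω s (c a) hαd hβd hα hβ (hN a) (hY a)
  -- smoothness
  have hcs : ∀ (a : ℝ) (f : X → ℝ), ContMDiff (𝓡 3) 𝓘(ℝ, ℝ) ∞ f →
      ContMDiff (𝓡 3) 𝓘(ℝ, ℝ) ∞ fun x ↦ a * f x := fun a f hf ↦
    (contDiff_const_smul a).comp_contMDiff hf
  have hNs : ∀ a, ContMDiff (𝓡 3) 𝓘(ℝ, ℝ) ∞ (N a) := fun a ↦ by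
    rw [show N a = fun x ↦ ∑ r ∈ s, c a r * ⟪α r x, β r x⟫ from funext (hN a)]
    exact ContMDiff.sum fun r _ ↦ hcs (c a r) _ (contMDiff_real_inner (hαs r) (hβs r))
  have hYs : ∀ a, ContMDiff (𝓡 3) ((𝓡 3).prod (𝓡 3)) ∞
      fun x ↦ (TotalSpace.mk' E3 x (Y a x) : TangentBundle (𝓡 3) X) := fun a ↦ by
    rw [show (fun x ↦ (TotalSpace.mk' E3 x (Y a x) : TangentBundle (𝓡 3) X)) =
      fun x ↦ (TotalSpace.mk' E3 x (∑ i, (∑ r ∈ s, c a r * ⟪α r x, σ i (β r x)⟫) • F i x) :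
        TangentBundle (𝓡 3) X) from funext fun x ↦ by rw [hY a x]]
    exact ContMDiff.sum_section fun i _ ↦
      (ContMDiff.sum fun r _ ↦ hcs (c a r) _
        (contMDiff_real_inner (hαs r) (contMDiff_clm_apply_comp (σ i) (hβs r)))).smul_section
        (hF i)
  -- Gram matrix: constant, `η` at `x₀`
  have hG : ∀ (x : X) a b, -(N a x * N b x) + D.h.inner x (Y a x) (Y b x) =
      if a = b then (if a = 0 then -1 else 1) else 0 := fun x a b ↦ by
    rw [kidPairing_eq_of_connectedSpace D N Y (fun a x ↦ (hNs a x).mdifferentiableAt (by simp))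
      (fun a x ↦ (hYs a x).mdifferentiableAt (by simp)) (fun a ↦ (hkid a).2) (fun a ↦ (hkid a).1)
      a b x x₀]
    exact hG₀ a b
  refine ⟨hNs, hYs, fun a ↦ (hkid a).2, fun a ↦ (hkid a).1, hG, ?_⟩
  have hG00 : ∀ x, -(N 0 x * N 0 x) + D.h.inner x (Y 0 x) (Y 0 x) = -1 := fun x ↦ by
    have h := hG x 0 0
    simpa using h
  exact lapse_pos_of_gram D (hNs 0).continuous hG00 hN₀

/-- **Translational KIDs with Gram matrix `η` from Sen–Witten-parallel spinors, asymptotic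
form.** As `exists_kids_of_parallel_spinors`, but with the Gram matrix and the sign of `N₀`
prescribed AT INFINITY rather than at a point: if along some nontrivial filter `l` on `X` (the
filter at infinity of the asymptotically flat end) `−N_aN_b + h(Y_a, Y_b) → η_{ab}` and
`N₀ → c₀ > 0`, the conclusion of `hA` holds. (The Gram matrix is constant,
`kidPairing_eq_of_connectedSpace`, so it equals its limit, `gram_eq_of_tendsto`; and `N₀ > 0`
near infinity propagates, `lapse_pos_of_gram`.) This is the form delivered by Witten's spinors,
which are asymptotic to constant spinors (Witten 1981, §3; Beig–Chruściel 1996, (A.8)–(A.9)).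
[cite: BeigChrusciel1996, App. A, (A.7)–(A.11.0) and Thm. 4.1] -/
theorem exists_kids_of_parallel_spinors_of_tendsto [ConnectedSpace X] (σ : Fin 3 → S →L[ℝ] S)
    (hsymm : ∀ i a b, ⟪σ i a, b⟫ = ⟪a, σ i b⟫)
    (hcl : ∀ i j a, σ i (σ j a) + σ j (σ i a) = if i = j then (2 : ℝ) • a else 0)
    {F : Fin 3 → Π x : X, TangentSpace (𝓡 3) x}
    (hF : ∀ i, ContMDiff (𝓡 3) ((𝓡 3).prod 𝓘(ℝ, E3)) ∞
      fun y ↦ (TotalSpace.mk' E3 y (F i y) : TangentBundle (𝓡 3) X))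
    (horth : ∀ x i j, D.h.inner x (F i x) (F j x) = if i = j then 1 else 0)
    (Ω : Fin 3 → Fin 3 → Π x : X, TangentSpace (𝓡 3) x → ℝ)
    (hω : ∀ i j x v, Ω i j x v = D.metric.val x (D.metric.leviCivita (F i) x v) (F j x))
    {ι : Type*} (s : Finset ι) (c : Fin 4 → ι → ℝ) {α β : ι → X → S}
    (hαs : ∀ r, ContMDiff (𝓡 3) 𝓘(ℝ, S) ∞ (α r)) (hβs : ∀ r, ContMDiff (𝓡 3) 𝓘(ℝ, S) ∞ (β r))
    (hα : ∀ r (x : X) (v : TangentSpace (𝓡 3) x), mvfderiv (𝓡 3) (α r) x v =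
      (1 / 4 : ℝ) • (∑ i, ∑ j, Ω i j x v • σ i (σ j (α r x))) -
        (1 / 2 : ℝ) • ∑ i, D.k x v (F i x) • σ i (α r x))
    (hβ : ∀ r (x : X) (v : TangentSpace (𝓡 3) x), mvfderiv (𝓡 3) (β r) x v =
      (1 / 4 : ℝ) • (∑ i, ∑ j, Ω i j x v • σ i (σ j (β r x))) -
        (1 / 2 : ℝ) • ∑ i, D.k x v (F i x) • σ i (β r x))
    (N : Fin 4 → X → ℝ) (hN : ∀ a x, N a x = ∑ r ∈ s, c a r * ⟪α r x, β r x⟫)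
    (Y : Fin 4 → Π x : X, TangentSpace (𝓡 3) x)
    (hY : ∀ a x, Y a x = ∑ i, (∑ r ∈ s, c a r * ⟪α r x, σ i (β r x)⟫) • F i x)
    {l : Filter X} [l.NeBot]
    (hGlim : ∀ a b, Tendsto (fun x ↦ -(N a x * N b x) + D.h.inner x (Y a x) (Y b x)) l
      (𝓝 (if a = b then (if a = 0 then -1 else 1) else 0)))
    {c₀ : ℝ} (hc₀ : 0 < c₀) (hN₀ : Tendsto (N 0) l (𝓝 c₀)) :
    (∀ a, ContMDiff (𝓡 3) 𝓘(ℝ, ℝ) ∞ (N a)) ∧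
      (∀ a, ContMDiff (𝓡 3) ((𝓡 3).prod (𝓡 3)) ∞
        fun x ↦ (TotalSpace.mk' E3 x (Y a x) : TangentBundle (𝓡 3) X)) ∧
      (∀ a (x : X) (v w : TangentSpace (𝓡 3) x),
        D.metric.val x (D.metric.leviCivita (Y a) x v) w = -(N a x * D.k x v w)) ∧
      (∀ a (x : X) (v : TangentSpace (𝓡 3) x),
        mvfderiv (𝓡 3) (N a) x v = -(D.k x v (Y a x))) ∧
      (∀ (x : X) a b, -(N a x * N b x) + D.h.inner x (Y a x) (Y b x) =
        if a = b then (if a = 0 then -1 else 1) else 0) ∧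
      ∀ x, 0 < N 0 x := by
  have hFd : ∀ i x, MDifferentiableAt (𝓡 3) ((𝓡 3).prod 𝓘(ℝ, E3))
      (fun y ↦ (TotalSpace.mk' E3 y (F i y) : TangentBundle (𝓡 3) X)) x := fun i x ↦
    (hF i x).mdifferentiableAt (by simp)
  have hαd : ∀ r, MDifferentiable (𝓡 3) 𝓘(ℝ, S) (α r) := fun r x ↦
    (hαs r x).mdifferentiableAt (by simp)
  have hβd : ∀ r, MDifferentiable (𝓡 3) 𝓘(ℝ, S) (β r) := fun r x ↦
    (hβs r x).mdifferentiableAt (by simp)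
  have hkid : ∀ a, (∀ (x : X) (v : TangentSpace (𝓡 3) x),
      mvfderiv (𝓡 3) (N a) x v = -(D.k x v (Y a x))) ∧
      ∀ (x : X) (v w : TangentSpace (𝓡 3) x),
        D.metric.val x (D.metric.leviCivita (Y a) x v) w = -(N a x * D.k x v w) := fun a ↦
    kid_of_parallel_sum D σ hsymm hcl hFd horth Ω hω s (c a) hαd hβd hα hβ (hN a) (hY a)
  -- smoothness
  have hcs : ∀ (a : ℝ) (f : X → ℝ), ContMDiff (𝓡 3) 𝓘(ℝ, ℝ) ∞ f →
      ContMDiff (𝓡 3) 𝓘(ℝ, ℝ) ∞ fun x ↦ a * f x := fun a f hf ↦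
    (contDiff_const_smul a).comp_contMDiff hf
  have hNs : ∀ a, ContMDiff (𝓡 3) 𝓘(ℝ, ℝ) ∞ (N a) := fun a ↦ by
    rw [show N a = fun x ↦ ∑ r ∈ s, c a r * ⟪α r x, β r x⟫ from funext (hN a)]
    exact ContMDiff.sum fun r _ ↦ hcs (c a r) _ (contMDiff_real_inner (hαs r) (hβs r))
  have hYs : ∀ a, ContMDiff (𝓡 3) ((𝓡 3).prod (𝓡 3)) ∞
      fun x ↦ (TotalSpace.mk' E3 x (Y a x) : TangentBundle (𝓡 3) X) := fun a ↦ by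
    rw [show (fun x ↦ (TotalSpace.mk' E3 x (Y a x) : TangentBundle (𝓡 3) X)) =
      fun x ↦ (TotalSpace.mk' E3 x (∑ i, (∑ r ∈ s, c a r * ⟪α r x, σ i (β r x)⟫) • F i x) :
        TangentBundle (𝓡 3) X) from funext fun x ↦ by rw [hY a x]]
    exact ContMDiff.sum_section fun i _ ↦
      (ContMDiff.sum fun r _ ↦ hcs (c a r) _
        (contMDiff_real_inner (hαs r) (contMDiff_clm_apply_comp (σ i) (hβs r)))).smul_section
        (hF i)
  -- Gram matrix: constant, hence equal to its limit `η`
  have hconst := kidPairing_eq_of_connectedSpace D N Y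
    (fun a x ↦ (hNs a x).mdifferentiableAt (by simp))
    (fun a x ↦ (hYs a x).mdifferentiableAt (by simp)) (fun a ↦ (hkid a).2) (fun a ↦ (hkid a).1)
  have hG : ∀ (x : X) a b, -(N a x * N b x) + D.h.inner x (Y a x) (Y b x) =
      if a = b then (if a = 0 then -1 else 1) else 0 := fun x a b ↦
    gram_eq_of_tendsto (fun a b x ↦ -(N a x * N b x) + D.h.inner x (Y a x) (Y b x))
      (fun a b ↦ if a = b then (if a = 0 then -1 else 1) else 0)
      (fun a b x x₀ ↦ hconst a b x x₀) hGlim a b x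
  -- a point where `N₀ > 0`
  obtain ⟨x₀, hx₀⟩ := (hN₀.eventually (lt_mem_nhds hc₀)).exists
  refine ⟨hNs, hYs, fun a ↦ (hkid a).2, fun a ↦ (hkid a).1, hG, ?_⟩
  have hG00 : ∀ x, -(N 0 x * N 0 x) + D.h.inner x (Y 0 x) (Y 0 x) = -1 := fun x ↦ by
    have h := hG x 0 0
    simpa using h
  exact lapse_pos_of_gram D (hNs 0).continuous hG00 hx₀

end Assembly

end SenParallel

end Literature.Geometry.Lorentzian

end
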